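import Summits.HubbardSuperconductivity.HubbardSuperconductivity.Theorems.AnisotropyChordTransferFibre3Hole2Fast
import Summits.HubbardSuperconductivity.HubbardSuperconductivity.Theorems.AnisotropyChordTransferFibre3Hole2Cert

/-!
# Route `AnisotropyChord` / H0 rotor rung: HOLE₂ per-`L` certificates — SOUNDNESS of the FAST checker (`…Fibre3Hole2Fast`)

* `sin_sum_zero`: the odd part of a row of the Green sum vanishes (`k₂ ↦ L − k₂` pairs the terms; `Finset.sum_involution`);
  `gterm_row_separable`: hence `Σ_{k₂} gterm = cos(2πk₁r₁/L) · Σ_{k₂} cterm` — the Green sum is SEPARABLE;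
* `mem_cRow`, `mem_gOuter`, `mem_gTabL`: the `O(L³)` tables `cTab`/`gTab` enclose `C(k₁,r₂)` and `Re G̃_{g_L}(r₁,r₂)`
  (p2's `TwoHoleBS.greenW`), via `…Hole2Green.greenW_re_eq` and the interval kit of `…Hole2Interval`;
* `gEncl_T`: the pair's `10 × 10` matrix read off the table satisfies the enclosure hypothesis `GEncl` of `…Hole2Sound`;
* `s2MatF_eq`, `kMatF_eq`, `tab_congr`: the factorised bookkeeping computes the same integers as `s2Mat`/`kMat`;
* ★ `twoHoleGap_of_checkRepsT`: `checkRepsT L reps = true` + `D₄`-coverage of the listed separations ⇒ `TwoHoleGap L (3/4·eps1 L)`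
  (generic soundness `twoHoleGapRealAt_of_cert` of `…Hole2Cert` with `G :=` the table matrix and `E := eMatZ`, then p1's
  `twoHoleGap_of_reps` / `twoHoleGap_mono`).
Prover seat `hubbard-h0-rotor-p3` g3; helper for stmt-HubbardSuperconductivity-19089 (`--supports`, helper class).
WHAT THIS IS NOT: nothing here proves superconductivity in the Hubbard model (rotor TARGET as worded stays FALSE, g15 verdict);
soundness of per-`L` certificates for ONE input (HOLE₂) of ONE conditional reduction (rung 19089). Tree imports only; no sorry.
-/

set_option linter.dupNamespace false
set_option autoImplicit false

namespace Summit.HubbardSuperconductivity.HubbardSuperconductivity.Theorems.AnisotropyChord.Transfer.Fibre3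

namespace Hole2

open scoped BigOperators
open Finset

/-! ## The odd part of a Green row vanishes; separability -/

/-- `ε` is even in the second momentum: `ε(k₁, L − k₂) = ε(k₁, k₂)` (`0 < k₂ < L`). [folklore] -/
theorem epsN_reflect (L : ℕ) {k1 k2 : ℕ} (hk2 : 0 < k2) (hk2L : k2 < L) : epsN L k1 (L - k2) = epsN L k1 k2 := by
  unfold epsN
  have hL : (L : ℝ) ≠ 0 := by exact_mod_cast (show L ≠ 0 by omega)
  rw [Nat.cast_sub hk2L.le, show 2 * Real.pi * ((L : ℝ) - k2) / L = 2 * Real.pi - 2 * Real.pi * k2 / L by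
    rw [mul_sub, sub_div, mul_div_assoc, div_self hL, mul_one], Real.cos_two_pi_sub]

/-- `sin(2π(L − k₂)r/L) = −sin(2πk₂r/L)`. [folklore] -/
theorem sin_reflect (L : ℕ) (hL : 0 < L) {k2 : ℕ} (hk2L : k2 < L) (r : ℕ) :
    Real.sin (2 * Real.pi * ((L - k2 : ℕ) : ℝ) * r / L) = -Real.sin (2 * Real.pi * k2 * r / L) := by
  have hLr : (L : ℝ) ≠ 0 := by exact_mod_cast (ne_of_gt hL)
  rw [Nat.cast_sub hk2L.le, show 2 * Real.pi * ((L : ℝ) - k2) * r / L = ((2 * r : ℕ) : ℝ) * Real.pi - 2 * Real.pi * k2 * r / L by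
    push_cast; field_simp]
  rw [Real.sin_sub, Real.sin_nat_mul_pi, Real.cos_nat_mul_pi]
  rw [show ((-1 : ℝ) ^ (2 * r)) = 1 by rw [pow_mul]; norm_num]
  ring

/-- ★ the odd part of a row vanishes: `Σ_{k₂<L, (k₁,k₂)≠0} sin(2πk₂r/L)/(ε(k₁,k₂) − g) = 0`. [folklore] -/
theorem sin_sum_zero (L : ℕ) (hL : 0 < L) (k1 r : ℕ) (g : ℝ) :
    ∑ k2 ∈ range L, (if k1 = 0 ∧ k2 = 0 then (0 : ℝ) else Real.sin (2 * Real.pi * k2 * r / L) / (epsN L k1 k2 - g)) = 0 := by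
  refine Finset.sum_involution (fun k2 _ => (L - k2) % L) ?_ ?_ ?_ ?_
  · intro k2 hk2
    rw [mem_range] at hk2
    by_cases h0 : k2 = 0
    · subst h0
      simp only [Nat.sub_zero, Nat.mod_self, Nat.cast_zero, mul_zero, zero_mul, zero_div, Real.sin_zero]
      split_ifs <;> simp
    · have hlt : L - k2 < L := by omega
      rw [Nat.mod_eq_of_lt hlt, if_neg (fun h => h0 h.2), if_neg (fun h => by omega), epsN_reflect L (by omega) hk2,
        sin_reflect L hL hk2 r]
      ring
  · intro k2 hk2 hne
    rw [mem_range] at hk2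
    intro heq
    apply hne
    by_cases h0 : k2 = 0
    · subst h0
      split_ifs <;> simp
    · have hlt : L - k2 < L := by omega
      rw [Nat.mod_eq_of_lt hlt] at heq
      -- `L = 2 k2`: the angle is `π r`
      have h2 : (L : ℝ) = 2 * k2 := by exact_mod_cast (show L = 2 * k2 by omega)
      rw [if_neg (fun h => h0 h.2), show 2 * Real.pi * (k2 : ℝ) * r / L = (r : ℝ) * Real.pi by rw [h2]; field_simp,
        Real.sin_nat_mul_pi, zero_div]
  · intro k2 _; exact mem_range.mpr (Nat.mod_lt _ hL)
  · intro k2 hk2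
    rw [mem_range] at hk2
    by_cases h0 : k2 = 0
    · subst h0; simp
    · have hlt : L - k2 < L := by omega
      rw [Nat.mod_eq_of_lt hlt, show L - (L - k2) = k2 by omega, Nat.mod_eq_of_lt hk2]

/-- the summand of the inner table `C(k₁, r₂)` read in `ℝ` (angle reduced mod `L`, as the checker's table lookup). [folklore] -/
noncomputable def cterm (L : ℕ) (g : ℝ) (r2 k1 k2 : ℕ) : ℝ :=
  if k1 = 0 ∧ k2 = 0 then 0 else Real.cos (2 * Real.pi * ((k2 * r2) % L : ℕ) / L) / (epsN L k1 k2 - g)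

/-- ★ SEPARABILITY of a Green row: `Σ_{k₂<L} gterm(r₁,r₂,k₁,k₂) = cos(2π((k₁r₁) mod L)/L) · Σ_{k₂<L} cterm(r₂,k₁,k₂)`. [folklore] -/
theorem gterm_row_separable (L : ℕ) (hL : 0 < L) (g : ℝ) (r1 r2 k1 : ℕ) :
    ∑ k2 ∈ range L, gterm L g r1 r2 k1 k2
      = Real.cos (2 * Real.pi * ((k1 * r1) % L : ℕ) / L) * ∑ k2 ∈ range L, cterm L g r2 k1 k2 := by
  have hs := sin_sum_zero L hL k1 r2 g
  rw [← cos_mod L hL, Finset.mul_sum, ← add_zero (∑ k2 ∈ range L, Real.cos _ * cterm L g r2 k1 k2),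
    ← mul_zero (-Real.sin (2 * Real.pi * ((k1 * r1 : ℕ) : ℝ) / L)), ← hs, Finset.mul_sum, ← Finset.sum_add_distrib]
  refine Finset.sum_congr rfl fun k2 _ => ?_
  unfold gterm cterm
  by_cases hk : k1 = 0 ∧ k2 = 0
  · simp [hk]
  · rw [if_neg hk, if_neg hk, if_neg hk, ← cos_mod L hL, ← cos_mod L hL]
    push_cast
    rw [show 2 * Real.pi * ((k1 : ℝ) * r1 + k2 * r2) / L = 2 * Real.pi * (k1 * r1) / L + 2 * Real.pi * k2 * r2 / L by ring,
      Real.cos_add, show 2 * Real.pi * ((k2 : ℝ) * r2) / L = 2 * Real.pi * k2 * r2 / L by ring]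
    ring

/-! ## The tables enclose `C` and `Re G̃` -/

/-- each inner summand is enclosed. [folklore] -/
theorem mem_cterm (L : ℕ) [NeZero L] (hL : 3 ≤ L) (hpos : epsPos L (cosTab L) (gFix L) = true) (r2 : ℕ) {k1 k2 : ℕ}
    (hk1 : k1 < L) (hk2 : k2 < L) (hk : ¬ (k1 = 0 ∧ k2 = 0)) :
    mem (cterm L (gR L) r2 k1 k2)
      (imul (getIv (cosTab L) ((k2 * r2) % L)) (getIv ((einvTab L (cosTab L) (gFix L)).getD k1 []) k2)) := by
  have hL0 : 0 < L := by omega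
  unfold cterm
  rw [if_neg hk, div_eq_mul_one_div]
  have hm : (k2 * r2) % L < L := Nat.mod_lt _ hL0
  rw [getIv_cosTab hm, getIv_einvTab _ _ hk1 hk2]
  refine mem_imul (mem_cosIv hL hm) (mem_iinv ?_ (epsPos_spec hpos hk1 hk2 hk))
  have := mem_epsIv L hL hk1 hk2
  rw [epsT_natCast L hk1 hk2] at this
  exact this

/-- row induction for the inner table. [folklore] -/
theorem mem_cRow (L : ℕ) [NeZero L] (hL : 3 ≤ L) (hpos : epsPos L (cosTab L) (gFix L) = true) (r2 : ℕ) {k1 : ℕ}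
    (hk1 : k1 < L) : ∀ n : ℕ, n ≤ L →
      mem (∑ k2 ∈ range n, cterm L (gR L) r2 k1 k2)
        (cRow L (cosTab L) ((einvTab L (cosTab L) (gFix L)).getD k1 []) k1 r2 n) := by
  intro n
  induction n with
  | zero =>
    intro _
    rw [Finset.sum_range_zero]
    have := mem_exact 0
    push_cast at this
    rw [zero_div] at this
    exact this
  | succ n ih =>
    intro hn
    rw [Finset.sum_range_succ]
    unfold cRow
    by_cases hk : k1 = 0 ∧ n = 0
    · rw [if_pos hk]
      have hz : cterm L (gR L) r2 k1 n = 0 := by unfold cterm; rw [if_pos hk]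
      rw [hz, add_zero]
      exact ih (by omega)
    · rw [if_neg hk]
      exact mem_iadd (ih (by omega)) (mem_cterm L hL hpos r2 hk1 (show n < L from hn) hk)

/-- lookup in the inner table. [folklore] -/
theorem getIv_cTab {L : ℕ} (ct : List Iv) (et : List (List Iv)) {k1 r2 : ℕ} (hk1 : k1 < L) (hr2 : r2 < L) :
    getIv ((cTab L ct et).getD k1 []) r2 = cRow L ct (et.getD k1 []) k1 r2 L := by
  unfold cTab getIv
  rw [getD_map_range _ _ hk1, getD_map_range _ _ hr2]

/-- spine induction for the outer sum. [folklore] -/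
theorem mem_gOuter (L : ℕ) [NeZero L] (hL : 3 ≤ L) (hpos : epsPos L (cosTab L) (gFix L) = true) {r1 r2 : ℕ} (hr2 : r2 < L) :
    ∀ n : ℕ, n ≤ L →
      mem (∑ k1 ∈ range n, Real.cos (2 * Real.pi * ((k1 * r1) % L : ℕ) / L) * ∑ k2 ∈ range L, cterm L (gR L) r2 k1 k2)
        (gOuter L (cosTab L) (cTab L (cosTab L) (einvTab L (cosTab L) (gFix L))) r1 r2 n) := by
  have hL0 : 0 < L := by omega
  intro n
  induction n with
  | zero =>
    intro _
    rw [Finset.sum_range_zero]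
    have := mem_exact 0
    push_cast at this
    rw [zero_div] at this
    exact this
  | succ n ih =>
    intro hn
    rw [Finset.sum_range_succ]
    unfold gOuter
    have hm : (n * r1) % L < L := Nat.mod_lt _ hL0
    refine mem_iadd (ih (by omega)) ?_
    rw [getIv_cosTab hm, getIv_cTab _ _ (show n < L from hn) hr2]
    exact mem_imul (mem_cosIv hL hm) (mem_cRow L hL hpos r2 (show n < L from hn) L le_rfl)

/-- ★ the Green table encloses `Re G̃_{g_L}`: entry `(r₁, r₂)`, `r₁, r₂ < L`. [folklore] -/
theorem mem_gTabL (L : ℕ) [NeZero L] (hL : 3 ≤ L) (hpos : epsPos L (cosTab L) (gFix L) = true) {r1 r2 : ℕ}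
    (h1 : r1 < L) (h2 : r2 < L) :
    mem (TwoHoleBS.greenW L (gR L) (((r1 : ℕ) : ZMod L), ((r2 : ℕ) : ZMod L))).re (getIv ((gTabL L).getD r1 []) r2) := by
  have hL0 : 0 < L := by omega
  unfold gTabL gTab getIv
  rw [getD_map_range _ _ h1, getD_map_range _ _ h2, greenW_re_eq L (gR L) h1 h2]
  unfold greenIvT
  rw [Finset.sum_congr rfl fun k1 _ => gterm_row_separable L hL0 (gR L) r1 r2 k1]
  have hLL : (0 : ℤ) < (L : ℤ) * L := by
    have : (0 : ℤ) < L := by exact_mod_cast hL0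
    positivity
  have h := mem_idivn (mem_gOuter L hL hpos h2 L le_rfl (r1 := r1)) hLL
  push_cast at h
  rw [sq]
  exact h

/-- ★ the pair matrix read off the table satisfies the enclosure hypothesis. [folklore] -/
theorem gEncl_T (L : ℕ) [NeZero L] (hL : 3 ≤ L) (hpos : epsPos L (cosTab L) (gFix L) = true) (s1 s2 : ℕ) :
    GEncl L s1 s2 (gMatT L (gTabL L) s1 s2) := by
  intro p q hp hq
  unfold gMatT getM getIv
  rw [getD_map_range _ _ hp, getD_map_range _ _ hq]
  unfold GR
  rw [ptT_sub L s1 s2 hL]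
  have h0 : 0 < L := by omega
  exact mem_gTabL L hL hpos (Nat.mod_lt _ h0) (Nat.mod_lt _ h0)

/-! ## The factorised bookkeeping computes the same integers -/

/-- tabulation depends only on the values inside the range. [folklore] -/
theorem tab_congr {α : Type} [Zero α] (n : ℕ) {M M' : ℕ → ℕ → α} (h : ∀ i j, i < n → j < n → M i j = M' i j) :
    tab n M = tab n M' := by
  funext i j
  unfold tab
  have hl : ((List.range n).map fun i => (List.range n).map fun j => M i j)
      = ((List.range n).map fun i => (List.range n).map fun j => M' i j) := by
    apply List.map_congr_left
    intro a ha
    apply List.map_congr_left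
    intro b hb
    exact h a b (List.mem_range.mp ha) (List.mem_range.mp hb)
  rw [hl]

/-- the factorised `S2` equals `s2Mat` inside the range. [folklore] -/
theorem s2MatF_eq (E X2 : ℕ → ℕ → ℤ) {p q : ℕ} (hq : q < 10) : s2MatF E X2 p q = s2Mat E X2 p q := by
  unfold s2MatF s2Mat
  congr 2
  refine Finset.sum_congr rfl fun a ha => ?_
  unfold xeTab
  rw [tab_eq 10 _ (mem_range.mp ha) hq, Finset.mul_sum]
  exact Finset.sum_congr rfl fun b _ => by ring

/-- aggregation over the free slots equals `kMat`. [folklore] -/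
theorem kMatF_eq (L s1 s2 : ℕ) (S2 : ℕ → ℕ → ℤ) : kMatF L s1 s2 S2 = kMat L s1 s2 S2 := by
  funext p q
  unfold kMatF kMat freeOf
  rw [Finset.sum_filter]
  refine Finset.sum_congr rfl fun a _ => ?_
  rw [Finset.sum_filter]
  by_cases ha : repOf L s1 s2 a = p ∧ isHole L s1 s2 a = false
  · rw [if_pos ha]
    refine Finset.sum_congr rfl fun b _ => ?_
    by_cases hb : repOf L s1 s2 b = q ∧ isHole L s1 s2 b = false
    · rw [if_pos hb, if_pos ⟨ha.1, hb.1, ha.2, hb.2⟩]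
    · rw [if_neg hb, if_neg (fun h => hb ⟨h.2.1, h.2.2.2⟩)]
  · rw [if_neg ha]
    symm
    refine Finset.sum_eq_zero fun b _ => ?_
    rw [if_neg (fun h => ha ⟨h.1, h.2.2.1⟩)]

/-- the fast pair test, unpacked into the hypotheses of `twoHoleGapRealAt_of_cert`. [folklore] -/
theorem checkPairG_spec {L : ℕ} {G : List (List Iv)} {s1 s2 : ℕ} (h : checkPairG L G s1 s2 = true) :
    ¬ (s1 % L = 0 ∧ s2 % L = 0) ∧ psdCheck 10 (k2Mat (KZ L s1 s2 G (eMatZ L G s1 s2))) = true := by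
  unfold checkPairG at h
  rw [Bool.and_eq_true, decide_eq_true_eq] at h
  refine ⟨h.1, ?_⟩
  have e : tab 10 (s2MatF (eMatZ L G s1 s2) (x2Mat G)) = tab 10 (s2Mat (eMatZ L G s1 s2) (x2Mat G)) :=
    tab_congr 10 fun i j _ hj => s2MatF_eq _ _ hj
  rw [kMatF_eq, e] at h
  exact h.2

/-- splitting the list of separations (to keep each kernel evaluation within the default budget). [folklore] -/
theorem checkRepsT_append {L : ℕ} {A B : List (ℕ × ℕ)} (hA : checkRepsT L A = true) (hB : checkRepsT L B = true) :
    checkRepsT L (A ++ B) = true := by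
  unfold checkRepsT at hA hB ⊢
  simp only [Bool.and_eq_true, List.all_append] at hA hB ⊢
  exact ⟨hA.1, hA.2, hB.2⟩

/-! ## Assembly -/

/-- ★ HOLE₂(.75) FROM THE FAST CHECK: if `checkRepsT L reps = true` and the listed separations meet every `D₄`-orbit, then
`TwoHoleGap L (3/4·eps1 L)`. [folklore] -/
theorem twoHoleGap_of_checkRepsT (L : ℕ) [NeZero L] (reps : List (ℕ × ℕ)) (h : checkRepsT L reps = true)
    (hcover : ∀ z : Tor L, z ≠ 0 → ∃ s ∈ (reps.map fun ab => sT L ab.1 ab.2).toFinset, s ∈ d4Orbit L z) :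
    TwoHoleGap L (3 / 4 * eps1 L) := by
  unfold checkRepsT at h
  rw [Bool.and_eq_true] at h
  obtain ⟨hpar, hall⟩ := h
  have hpar' := hpar
  unfold checkParams at hpar'
  simp only [Bool.and_eq_true, decide_eq_true_eq] at hpar'
  obtain ⟨⟨⟨⟨hL, _⟩, _⟩, hglt'⟩, hpos⟩ := hpar'
  rw [List.all_eq_true] at hall
  refine twoHoleGap_mono L (gFix_ge L hL) (twoHoleGap_of_reps L _ hcover fun s hs => ?_)
  rw [List.mem_toFinset, List.mem_map] at hs
  obtain ⟨ab, hab, rfl⟩ := hs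
  obtain ⟨hne, hpsd⟩ := checkPairG_spec (hall ab hab)
  exact twoHoleGapRealAt_of_cert L ab.1 ab.2 hL hglt' hne _ (gEncl_T L hL hpos ab.1 ab.2) _ hpsd

end Hole2

end Summit.HubbardSuperconductivity.HubbardSuperconductivity.Theorems.AnisotropyChord.Transfer.Fibre3
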